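import Summits.ValiantsHypothesis.ValiantsHypothesis.Theses.ProjectionStability
import Literature.Computability.AlgebraicComplexity.LandsbergRessayreNormalForm
import Literature.Computability.AlgebraicComplexity.LRPencilOfMatrix

/-!
# `UniqStep` / `UniqBase` (cruxes stmt-ValiantsHypothesis-17834 / -17836, route `ProjectionStability`):
# gauge invariants for orbit tests at every level (negative-side support)

The uniqueness clauses of the route relate two honest projections `A`, `B` of `per_n` by
`B = P·A(γx)·Q` or `B = P·A(γx)ᵀ·Q` with constant `P, Q ∈ GL_m(ℂ)` and `γ ∈ permSymmetrySubst ℂ n`.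
A candidate SECOND ORBIT (the crux's kill criterion at `(n, m) = (4, 15)`, or a counterexample to the base at
`(3, 7)`) is certified as soon as a gauge invariant separates the pair.  This file proves the two first
invariants once and for all `n, m`:

* `rank_constPart_eq_of_gaugeRel` — the rank of the constant part (`γ` fixes constants,
  `constPart_linSubstEntries`); decisive at level 2 (`Negative/UniqTwoFalse.lean`), void at levels 3, 4
  where every affine representation of `per_n` of size `m` has constant part of rank `m − 1`;
* `exists_injective_rank_coeffMat_eq` — the COEFFICIENT-RANK PROFILE: there is an injective (so bijective)
  relabelling `w` of the `n²` variables with `rank (coeffMat B v) = rank (coeffMat A (w v))`, because every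
  realised symmetry acts MONOMIALLY on the variables (`permSymmetrySubst_row_monomial`, for every `n`; the
  `n = 3` case is inline in `Theorems/GrenetRigidityOptimalUniqueRefutation.lean` and
  `Negative/UniqThreeFalseWithSignedEntries.lean`) and an invertible row-monomial matrix has non-zero row
  scalars and an injective column choice (`row_monomial_unit`).

Refuter cdisprove cycle 1, 2026-08-17.  No statement of the route is asserted.
-/

noncomputable section

set_option linter.dupNamespace false

namespace Summit.ValiantsHypothesis.ValiantsHypothesis.Theorems.UniqStep.Negative.GaugeInvariants

open MvPolynomial Literature.Computability.AlgebraicComplexity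
open Literature.Computability.AlgebraicComplexity.LRPencil
open scoped Matrix Kronecker

variable {n m : ℕ}

/-- The constant part of a transpose. [folklore] -/
theorem constPart_transpose {ι σ : Type*} (M : Matrix ι ι (MvPolynomial σ ℂ)) :
    constPart Mᵀ = (constPart M)ᵀ := Matrix.transpose_map


/-- The rank of the constant part is invariant under the crux's gauge relation. [folklore] -/
theorem rank_constPart_eq_of_gaugeRel {A B : Matrix (Fin m) (Fin m) (MvPolynomial (Fin n × Fin n) ℂ)}
    {P Q : GL (Fin m) ℂ} {γ : GL (Fin n × Fin n) ℂ}
    (h : B = (P : Matrix _ _ ℂ).map C * Matrix.linSubstEntries γ A * (Q : Matrix _ _ ℂ).map C ∨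
      B = (P : Matrix _ _ ℂ).map C * (Matrix.linSubstEntries γ A)ᵀ * (Q : Matrix _ _ ℂ).map C) :
    (constPart B).rank = (constPart A).rank := by
  have hP : IsUnit (P : Matrix (Fin m) (Fin m) ℂ).det :=
    (Matrix.isUnit_iff_isUnit_det _).1 (Units.isUnit P)
  have hQ : IsUnit (Q : Matrix (Fin m) (Fin m) ℂ).det :=
    (Matrix.isUnit_iff_isUnit_det _).1 (Units.isUnit Q)
  rcases h with e | e
  · have key := congrArg constPart e
    rw [constPart_mul, constPart_mul, constPart_map_C, constPart_map_C, constPart_linSubstEntries] at key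
    rw [key, Matrix.rank_mul_eq_left_of_isUnit_det _ _ hQ, Matrix.rank_mul_eq_right_of_isUnit_det _ _ hP]
  · have key := congrArg constPart e
    rw [constPart_mul, constPart_mul, constPart_map_C, constPart_map_C, constPart_transpose,
      constPart_linSubstEntries] at key
    rw [key, Matrix.rank_mul_eq_left_of_isUnit_det _ _ hQ, Matrix.rank_mul_eq_right_of_isUnit_det _ _ hP,
      Matrix.rank_transpose]

/-- **Every realised symmetry of `per_n` is a MONOMIAL substitution of the `n²` variables** (each row of
`γ ∈ permSymmetrySubst ℂ n` has at most one non-zero entry): the closure of Kronecker products of monomial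
matrices with `1` and of the transposition permutation.  (The `n = 3` instance is proved inline in
`Theorems/GrenetRigidityOptimalUniqueRefutation.lean`; same proof.) [cite: LandsbergRessayre2017, §2.1] -/
theorem permSymmetrySubst_row_monomial {γ : GL (Fin n × Fin n) ℂ} (hγ : γ ∈ permSymmetrySubst ℂ n) :
    ∀ i, ∃ (j : Fin n × Fin n) (c : ℂ), ∀ j',
      (γ : Matrix (Fin n × Fin n) (Fin n × Fin n) ℂ) i j' = if j' = j then c else 0 := by
  -- adapted from Summits/ValiantsHypothesis/ValiantsHypothesis/Theorems/GrenetRigidityOptimalUniqueRefutation.lean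
  have rm_mul : ∀ {ι : Type} [Fintype ι] [DecidableEq ι] {M N : Matrix ι ι ℂ},
      (∀ i, ∃ (j : ι) (c : ℂ), ∀ j', M i j' = if j' = j then c else 0) →
      (∀ i, ∃ (j : ι) (c : ℂ), ∀ j', N i j' = if j' = j then c else 0) →
      ∀ i, ∃ (j : ι) (c : ℂ), ∀ j', (M * N) i j' = if j' = j then c else 0 := by
    intro ι _ _ M N hM hN i
    obtain ⟨j, c, hj⟩ := hM i
    obtain ⟨l, d, hl⟩ := hN j
    refine ⟨l, c * d, fun j' => ?_⟩
    simp only [Matrix.mul_apply, hj, ite_mul, zero_mul, Finset.sum_ite_eq', Finset.mem_univ, if_true,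
      hl, mul_ite, mul_zero]
  have rm_diag : ∀ {ι : Type} [DecidableEq ι] (d : ι → ℂ),
      ∀ i, ∃ (j : ι) (c : ℂ), ∀ j', Matrix.diagonal d i j' = if j' = j then c else 0 := by
    intro ι _ d i
    refine ⟨i, d i, fun j' => ?_⟩
    by_cases h : j' = i
    · subst h; simp
    · simp [h, Matrix.diagonal_apply_ne _ (Ne.symm h)]
  have rm_perm : ∀ {ι : Type} [DecidableEq ι] (π : Equiv.Perm ι),
      ∀ i, ∃ (j : ι) (c : ℂ), ∀ j', π.permMatrix ℂ i j' = if j' = j then c else 0 := fun π i =>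
    ⟨π i, 1, fun j' => by simp [Equiv.Perm.permMatrix, PEquiv.toMatrix_apply, Equiv.toPEquiv_apply, eq_comm]⟩
  have inv_perm : ∀ {ι : Type} [Fintype ι] [DecidableEq ι] (π : Equiv.Perm ι),
      (π.permMatrix ℂ)⁻¹ = π⁻¹.permMatrix ℂ := by
    intro ι _ _ π
    apply Matrix.inv_eq_right_inv
    rw [← Matrix.permMatrix_mul, inv_mul_cancel, Matrix.permMatrix_one]
  have rm_kron : ∀ {ι κ : Type} [DecidableEq ι] [DecidableEq κ] {M : Matrix ι ι ℂ},
      (∀ i, ∃ (j : ι) (c : ℂ), ∀ j', M i j' = if j' = j then c else 0) →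
      (∀ i, ∃ (j : ι × κ) (c : ℂ), ∀ j', (M ⊗ₖ (1 : Matrix κ κ ℂ)) i j' = if j' = j then c else 0) ∧
      (∀ i, ∃ (j : κ × ι) (c : ℂ), ∀ j', ((1 : Matrix κ κ ℂ) ⊗ₖ M) i j' = if j' = j then c else 0) := by
    intro ι κ _ _ M hM
    constructor
    · rintro ⟨i, k⟩
      obtain ⟨j, c, hj⟩ := hM i
      refine ⟨(j, k), c, ?_⟩
      rintro ⟨j', k'⟩
      simp only [Matrix.kronecker_apply, hj, Matrix.one_apply, Prod.mk.injEq]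
      by_cases h1 : j' = j <;> by_cases h2 : k = k' <;> simp [h1, h2, eq_comm]
    · rintro ⟨k, i⟩
      obtain ⟨j, c, hj⟩ := hM i
      refine ⟨(k, j), c, ?_⟩
      rintro ⟨k', j'⟩
      simp only [Matrix.kronecker_apply, hj, Matrix.one_apply, Prod.mk.injEq]
      by_cases h1 : j' = j <;> by_cases h2 : k = k' <;> simp [h1, h2, eq_comm]
  have rm_mono : ∀ {m : ℕ} {g : GL (Fin m) ℂ}, g ∈ monomialSubgroup ℂ m →
      ∀ i, ∃ (j : Fin m) (c : ℂ), ∀ j', (g : Matrix (Fin m) (Fin m) ℂ) i j' = if j' = j then c else 0 := by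
    intro m g hg
    induction hg using Subgroup.closure_induction'' with
    | mem x hx =>
      rcases hx with ⟨π, hπ⟩ | ⟨d, hd⟩
      · rw [hπ]; exact rm_perm π
      · rw [hd]; exact rm_diag d
    | inv_mem x hx =>
      rcases hx with ⟨π, hπ⟩ | ⟨d, hd⟩
      · rw [Matrix.coe_units_inv, hπ, inv_perm]; exact rm_perm _
      · rw [Matrix.coe_units_inv, hd, Matrix.inv_diagonal]; exact rm_diag _
    | one => simpa using rm_diag (fun _ : Fin m => (1 : ℂ))
    | mul x y _ _ hx hy => rw [Units.val_mul]; exact rm_mul hx hy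
  have hleft : ∀ {γ : GL (Fin n × Fin n) ℂ}, γ ∈ leftMonomialSubst ℂ n →
      ∀ i, ∃ (j : Fin n × Fin n) (c : ℂ), ∀ j',
        (γ : Matrix (Fin n × Fin n) (Fin n × Fin n) ℂ) i j' = if j' = j then c else 0 := by
    intro γ hγ
    induction hγ using Subgroup.closure_induction'' with
    | mem x hx =>
      obtain ⟨g, hg, hx⟩ := hx
      rw [hx]; exact (rm_kron (rm_mono hg)).1
    | inv_mem x hx =>
      obtain ⟨g, hg, hx⟩ := hx
      rw [Matrix.coe_units_inv, hx, Matrix.inv_kronecker, inv_one, ← Matrix.coe_units_inv]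
      exact (rm_kron (rm_mono (Subgroup.inv_mem _ hg))).1
    | one => simpa using rm_diag (fun _ : Fin n × Fin n => (1 : ℂ))
    | mul x y _ _ hx hy => rw [Units.val_mul]; exact rm_mul hx hy
  have hright : ∀ {γ : GL (Fin n × Fin n) ℂ}, γ ∈ rightMonomialSubst ℂ n →
      ∀ i, ∃ (j : Fin n × Fin n) (c : ℂ), ∀ j',
        (γ : Matrix (Fin n × Fin n) (Fin n × Fin n) ℂ) i j' = if j' = j then c else 0 := by
    intro γ hγ
    induction hγ using Subgroup.closure_induction'' with
    | mem x hx =>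
      obtain ⟨g, hg, hx⟩ := hx
      rw [hx]; exact (rm_kron (rm_mono hg)).2
    | inv_mem x hx =>
      obtain ⟨g, hg, hx⟩ := hx
      rw [Matrix.coe_units_inv, hx, Matrix.inv_kronecker, inv_one, ← Matrix.coe_units_inv]
      exact (rm_kron (rm_mono (Subgroup.inv_mem _ hg))).2
    | one => simpa using rm_diag (fun _ : Fin n × Fin n => (1 : ℂ))
    | mul x y _ _ hx hy => rw [Units.val_mul]; exact rm_mul hx hy
  induction hγ using Subgroup.closure_induction'' with
  | mem x hx =>
    rcases hx with (hx | hx) | hx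
    · exact hleft hx
    · exact hright hx
    · have hx' : (x : Matrix (Fin n × Fin n) (Fin n × Fin n) ℂ) =
          Equiv.Perm.permMatrix ℂ (Equiv.prodComm (Fin n) (Fin n)) := hx
      rw [hx']; exact rm_perm _
  | inv_mem x hx =>
    rcases hx with (hx | hx) | hx
    · exact hleft (Subgroup.inv_mem _ hx)
    · exact hright (Subgroup.inv_mem _ hx)
    · have hx' : (x : Matrix (Fin n × Fin n) (Fin n × Fin n) ℂ) =
          Equiv.Perm.permMatrix ℂ (Equiv.prodComm (Fin n) (Fin n)) := hx
      rw [Matrix.coe_units_inv, hx', inv_perm]; exact rm_perm _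
  | one => simpa using rm_diag (fun _ : Fin n × Fin n => (1 : ℂ))
  | mul x y _ _ hx hy => rw [Units.val_mul]; exact rm_mul hx hy

/-- For an INVERTIBLE row-monomial matrix the row scalars are non-zero and the column choice is injective.
[folklore] -/
theorem row_monomial_unit {ι : Type*} [Fintype ι] [DecidableEq ι] (γ : GL ι ℂ) (w : ι → ι) (c : ι → ℂ)
    (h : ∀ i j', (γ : Matrix ι ι ℂ) i j' = if j' = w i then c i else 0) :
    (∀ i, c i ≠ 0) ∧ Function.Injective w := by
  have key : (γ : Matrix ι ι ℂ) * ((γ⁻¹ : GL ι ℂ) : Matrix ι ι ℂ) = 1 := by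
    rw [← Units.val_mul, mul_inv_cancel, Units.val_one]
  have entry : ∀ i i', c i * ((γ⁻¹ : GL ι ℂ) : Matrix ι ι ℂ) (w i) i' = if i = i' then 1 else 0 := by
    intro i i'
    have := congrFun (congrFun key i) i'
    rw [Matrix.mul_apply, Matrix.one_apply] at this
    simpa only [h, ite_mul, zero_mul, Finset.sum_ite_eq', Finset.mem_univ, if_true] using this
  have hc : ∀ i, c i ≠ 0 := by
    intro i hci
    have := entry i i
    rw [hci, zero_mul, if_pos rfl] at this
    exact zero_ne_one this
  refine ⟨hc, fun i i' hw => ?_⟩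
  by_contra hne
  have h1 := entry i i'
  have h2 := entry i' i'
  rw [if_neg hne, hw] at h1
  rw [if_pos rfl] at h2
  have hinv : ((γ⁻¹ : GL ι ℂ) : Matrix ι ι ℂ) (w i') i' ≠ 0 := by
    intro hz; rw [hz, mul_zero] at h2; exact zero_ne_one h2
  exact (mul_ne_zero (hc i) hinv) h1

/-- Honest matrices are affine. [folklore] -/
theorem totalDegree_le_one_of_honest {A : Matrix (Fin m) (Fin m) (MvPolynomial (Fin n × Fin n) ℂ)}
    (hA : ∀ i j, (∃ v, A i j = X v) ∨ ∃ c, A i j = C c) : ∀ i j, (A i j).totalDegree ≤ 1 := by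
  intro i j
  rcases hA i j with ⟨v, hv⟩ | ⟨c, hc⟩
  · rw [hv, totalDegree_X]
  · rw [hc, totalDegree_C]; exact Nat.zero_le _

/-- **The coefficient-rank profile is a gauge invariant.**  If `B = P·A(γx)·Q` or `B = P·A(γx)ᵀ·Q` with
`γ ∈ permSymmetrySubst ℂ n` and `A` honest, then there is an injective (hence bijective) relabelling
`w` of the variables with `rank (coeffMat B v) = rank (coeffMat A (w v))` for every `v`; in particular the
multisets of coefficient ranks of `A` and `B` coincide.  First test for any candidate second orbit.
[folklore] -/
theorem exists_injective_rank_coeffMat_eq {A B : Matrix (Fin m) (Fin m) (MvPolynomial (Fin n × Fin n) ℂ)}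
    {P Q : GL (Fin m) ℂ} {γ : GL (Fin n × Fin n) ℂ} (hγ : γ ∈ permSymmetrySubst ℂ n)
    (hA : ∀ i j, (∃ v, A i j = X v) ∨ ∃ c, A i j = C c)
    (h : B = (P : Matrix _ _ ℂ).map C * Matrix.linSubstEntries γ A * (Q : Matrix _ _ ℂ).map C ∨
      B = (P : Matrix _ _ ℂ).map C * (Matrix.linSubstEntries γ A)ᵀ * (Q : Matrix _ _ ℂ).map C) :
    ∃ w : Fin n × Fin n → Fin n × Fin n, Function.Injective w ∧
      ∀ v, (coeffMat B v).rank = (coeffMat A (w v)).rank := by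
  choose w c hwc using permSymmetrySubst_row_monomial hγ
  obtain ⟨hc, hinj⟩ := row_monomial_unit γ w c (fun i j' => hwc i j')
  have hP : IsUnit (P : Matrix (Fin m) (Fin m) ℂ).det :=
    (Matrix.isUnit_iff_isUnit_det _).1 (Units.isUnit P)
  have hQ : IsUnit (Q : Matrix (Fin m) (Fin m) ℂ).det :=
    (Matrix.isUnit_iff_isUnit_det _).1 (Units.isUnit Q)
  have hdeg := totalDegree_le_one_of_honest hA
  have hL : ∀ v, coeffMat (Matrix.linSubstEntries γ A) v = c v • coeffMat A (w v) := by
    intro v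
    rw [coeffMat_linSubstEntries γ A hdeg v]
    simp only [hwc v, ite_smul, zero_smul, Finset.sum_ite_eq', Finset.mem_univ, if_true]
  have hsmul : ∀ (v) (M : Matrix (Fin m) (Fin m) ℂ), (c v • M).rank = M.rank := by
    intro v M
    rw [Matrix.smul_eq_diagonal_mul]
    refine Matrix.rank_mul_eq_right_of_isUnit_det _ _ ?_
    rw [Matrix.det_diagonal, Finset.prod_const]
    exact (isUnit_iff_ne_zero.2 (hc v)).pow _
  refine ⟨w, hinj, fun v => ?_⟩
  rcases h with e | e
  · rw [e, coeffMat_C_mul_mul_C, Matrix.rank_mul_eq_left_of_isUnit_det _ _ hQ,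
      Matrix.rank_mul_eq_right_of_isUnit_det _ _ hP, hL, hsmul]
  · have ht : coeffMat (Matrix.linSubstEntries γ A)ᵀ v = (coeffMat (Matrix.linSubstEntries γ A) v)ᵀ :=
      Matrix.transpose_map
    rw [e, coeffMat_C_mul_mul_C, Matrix.rank_mul_eq_left_of_isUnit_det _ _ hQ,
      Matrix.rank_mul_eq_right_of_isUnit_det _ _ hP, ht, Matrix.rank_transpose, hL, hsmul]


end Summit.ValiantsHypothesis.ValiantsHypothesis.Theorems.UniqStep.Negative.GaugeInvariants

end
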